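import Literature.Analysis.FluidPDE.AxisymmetricEuler
import Literature.Analysis.FunctionSpaces.HolderNorm
import HarnessLib

/-!
# Elgindi–Pasqualotto: swirl-driven `C^{1,α}` blow-up of axisymmetric 3D Euler on a ring, away from
# the axis (Taylor–Couette mechanism) — the printed Theorem 1.3 as a CLAIM

Topic `Literature/Analysis/FluidPDE`. Statements file: ONE named statement tagged as a claim (the source
is an unrefereed preprint with a computer-assisted step, §1.4.6), in the tree's Hölder–Euler vocabulary,
plus its elementary consequences. Source: `[ElgindiPasqualotto2023]` T. M. Elgindi, F. Pasqualotto,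
*From Instability to Singularity Formation in Incompressible Fluids*, arXiv:2310.19780 (Oct 2023)
("p." = chunk of the held text `paper:arxiv-2310.19780`).

## The printed statement (§1.2, p. 4)

**Theorem 1.3.** "Let `𝒞₀` be a circle centered at the origin, contained in the `x₁x₂` plane. There
exists `α_* > 0` and finite-energy, axisymmetric (with respect to the `x₃`-axis) initial data
`u₀ ∈ C^{1,α_*}(ℝ³) ∩ C^∞(ℝ³ ∖ 𝒞₀)` for which the local solution to the 3d Euler system
`∂ₜu + u·∇u + ∇p = 0`, `div(u) = 0`, `u|_{t=0} = u₀` becomes singular in finite time. Moreover, the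
vorticity remains smooth prior to the blow-up time as a function of `(r^{α_*}, θ, φ)`, where `(r, θ, φ)`
are the toroidal coordinates adapted to a circle `𝒞(t)` which varies continuously in time, such that
`𝒞(0) = 𝒞₀`." Remark 1.4: "in this construction, the swirl component is what drives the singularity.
At zeroth order, the effect of the swirl is a manifestation of the classical Taylor–Couette
instability." §1.1 p. 3: "classical solutions existing on an interval `[0, T_*)` can be shown to exist
past `T_* < ∞` if and only if `lim_{t→T_*} ∫₀ᵗ |∇u|_{L^∞} < ∞`" (the sense of "becomes singular").
Remark 1.2 p. 4: the data can be taken in `H^{2+δ}` (angular smoothness at the blow-up point), a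
regularity at which swirl-free axisymmetric flows cannot blow up ([Danchin]); p. 4: "since the square of
the swirl necessarily increases as we leave the axis, the underlying instability mechanism does not
seem to be of help at the axis"; §1.4.5 p. 8 and §8 p. 33: the blow-up point is modulated along a
circle of radius `ξ(t)`, the construction keeps the support away from the symmetry axis, and 3d
axisymmetric Euler off the axis is treated as a perturbation of 2d Boussinesq (`ρ = r⁻¹u_θ²`);
§1.4.6: the invertibility of the linearised operator uses computer assistance. Companion Theorem 1.1
(2d Boussinesq on `ℝ²`, data `C^{1,α_*}(ℝ²) ∩ C^∞(ℝ² ∖ {0})`) is not rendered here.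

## Rendering

`ElgindiPasqualotto2023.swirlDrivenHolderBlowup` [claim: under-review]: for every radius `r₀ > 0`
(the circle `𝒞₀ = {x₂… = 0, r = r₀}` — `horizontalCircle r₀`, with `r = cylRadius`) there are
`α > 0`, a datum `u₀ : ℝ³ → ℝ³` of class `C^{1,α}` (`MemC1Holder`), with finite energy, divergence
free, axisymmetric, NOT swirl-free (Remark 1.4), `C^∞` on `ℝ³ ∖ 𝒞₀`, a time `0 < T < ∞` and a classical
solution `(u, p)` of the incompressible Euler equations (`f = 0`) on `ℝ³ × [0, T)`
(`IsClassicalEulerOnDomain (Ico 0 T) ⊤ 0 0`) with `u(0) = u₀`, slices `C^{1,α}` with finite energy and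
axisymmetric, whose Lipschitz integral diverges at `T`: `∫_{(0,t)} ‖∇u(s)‖_{L^∞} ds → ∞` as `t ↑ T`
(`‖∇u(s)‖_{L^∞}` = `eSupNorm` of the Fréchet derivative). Not rendered: uniqueness ("the local
solution"), the toroidal-coordinate smoothness and the moving circle `𝒞(t)`, `H^{2+δ}` data.
Proved: the divergence forbids a uniform Lipschitz bound on `[0,T)` (`not_lipschitzBound`), and the
packaged existence statement `exists_blowup`.

## What this is NOT (and why it does not transfer to viscosity as stated)

Not Navier–Stokes: inviscid, `C^{1,α}` data with `α` small, computer-assisted invertibility. The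
singular locus is a RING at positive distance from the axis; for the Navier–Stokes equations every
singular point of an axisymmetric suitable weak solution lies ON the axis (Caffarelli–Kohn–Nirenberg
partial regularity, tree `ckn_partial_regularity`: the singular set has vanishing one-dimensional
parabolic measure and is rotation invariant), so no viscous analogue of this ring scenario exists in
the Leray–Hopf class.
-/

noncomputable section

open MeasureTheory Set Function Filter
open _root_.Topology
open scoped NNReal ENNReal ContDiff

namespace Literature.Analysis.FluidPDE

namespace ElgindiPasqualotto2023

/-- The circle of cylindrical radius `r₀` in the plane `{x₂ = 0}` centred at the origin (the printed
`𝒞₀`: "a circle centered at the origin, contained in the `x₁x₂` plane"; coordinates `x 0, x 1, x 2`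
of `EuclideanSpace ℝ (Fin 3)`, axis = the `x 2`-axis of the tree's `IsAxisymmetric`). [cite: ElgindiPasqualotto2023, Thm 1.3 (p. 4 of arXiv:2310.19780)] -/
def horizontalCircle (r₀ : ℝ) : Set (EuclideanSpace ℝ (Fin 3)) :=
  {x | x 2 = 0 ∧ cylRadius x = r₀}

/-- Membership in `horizontalCircle r₀`. [cite: ElgindiPasqualotto2023, Thm 1.3 (p. 4)] -/
@[simp] theorem mem_horizontalCircle {r₀ : ℝ} {x : EuclideanSpace ℝ (Fin 3)} :
    x ∈ horizontalCircle r₀ ↔ x 2 = 0 ∧ cylRadius x = r₀ :=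
  Iff.rfl

/-- The circle misses the axis when `r₀ ≠ 0` (points of the axis have `cylRadius = 0`): the singular
locus of the datum is away from the symmetry axis. [cite: ElgindiPasqualotto2023, §1.4.5 (p. 8): "the support of our solution stays away from the axis"] -/
theorem not_mem_horizontalCircle_of_cylRadius_eq_zero {r₀ : ℝ} (hr₀ : r₀ ≠ 0)
    {x : EuclideanSpace ℝ (Fin 3)} (hx : cylRadius x = 0) : x ∉ horizontalCircle r₀ := by
  rintro ⟨-, h⟩
  exact hr₀ (h.symm.trans hx)

/-- **Elgindi–Pasqualotto, Theorem 1.3 — a CLAIM (arXiv:2310.19780, unrefereed; computer-assisted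
invertibility, §1.4.6).** Printed (§1.2 p. 4): "Let `𝒞₀` be a circle centered at the origin, contained
in the `x₁x₂` plane. There exists `α_* > 0` and finite-energy, axisymmetric (with respect to the
`x₃`-axis) initial data `u₀ ∈ C^{1,α_*}(ℝ³) ∩ C^∞(ℝ³ ∖ 𝒞₀)` for which the local solution to the 3d Euler
system … becomes singular in finite time. Moreover, the vorticity remains smooth prior to the blow-up
time as a function of `(r^{α_*}, θ, φ)` …"; Remark 1.4: "the swirl component is what drives the
singularity"; singular = `lim_{t→T_*}∫₀ᵗ|∇u|_{L^∞} = ∞` (§1.1 p. 3). **Rendering** (module docstring):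
for every `r₀ > 0` there are `α > 0`, a `C^{1,α}`, finite-energy, divergence-free, axisymmetric datum
`u₀` with non-vanishing swirl, `C^∞` off `horizontalCircle r₀`, a time `T > 0` and a classical Euler
solution `(u, p)` on `ℝ³ × [0,T)` from `u₀`, with `C^{1,α}` finite-energy axisymmetric slices, such that
`∫_{(0,t)} ‖∇u(s)‖_{L^∞} ds → ∞` as `t ↑ T`. Not rendered: uniqueness, the adapted toroidal
smoothness, the moving circle `𝒞(t)`, `H^{2+δ}` regularity of the data (Remark 1.2). [claim: ElgindiPasqualotto2023, status: under-review]
[cite: ElgindiPasqualotto2023, Thm 1.3 with Remarks 1.2, 1.4 (p. 4 of arXiv:2310.19780); §1.1 (p. 3); §1.4.5 (p. 8); §8 (p. 33)] -/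
def swirlDrivenHolderBlowup : Prop :=
  ∀ r₀ : ℝ, 0 < r₀ →
    ∃ (α : ℝ≥0) (u₀ : EuclideanSpace ℝ (Fin 3) → EuclideanSpace ℝ (Fin 3)), 0 < α ∧
      MemC1Holder α u₀ ∧ HasFiniteEnergy u₀ ∧ VectorCalculus.IsDivFree u₀ ∧ IsAxisymmetric u₀ ∧
      ¬ HasNoSwirl u₀ ∧ ContDiffOn ℝ ∞ u₀ (horizontalCircle r₀)ᶜ ∧
      ∃ T : ℝ, 0 < T ∧
        ∃ (u : ℝ → EuclideanSpace ℝ (Fin 3) → EuclideanSpace ℝ (Fin 3))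
          (p : ℝ → EuclideanSpace ℝ (Fin 3) → ℝ),
          IsClassicalEulerOnDomain (Ico 0 T) (⊤ : TopologicalSpace.Opens (EuclideanSpace ℝ (Fin 3)))
              0 0 u p ∧
            u 0 = u₀ ∧
            (∀ t ∈ Ico 0 T, MemC1Holder α (u t) ∧ HasFiniteEnergy (u t) ∧ IsAxisymmetric (u t)) ∧
            Tendsto (fun t : ℝ => ∫⁻ s in Ioo 0 t, FunctionSpaces.eSupNorm (fderiv ℝ (u s)))
              (𝓝[<] T) (𝓝 (⊤ : ℝ≥0∞))

/-- The divergence of `∫₀ᵗ ‖∇u‖_{L^∞}` as `t ↑ T`, `0 < T`, forbids a uniform Lipschitz bound on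
`[0, T)` (the integral over `(0,t) ⊆ (0,T)` would stay below `C·T`). [cite: ElgindiPasqualotto2023, §1.1 (p. 3): the continuation criterion] -/
theorem not_lipschitzBound {u : ℝ → EuclideanSpace ℝ (Fin 3) → EuclideanSpace ℝ (Fin 3)} {T : ℝ}
    (hT : 0 < T)
    (hdiv : Tendsto (fun t : ℝ => ∫⁻ s in Ioo 0 t, FunctionSpaces.eSupNorm (fderiv ℝ (u s)))
      (𝓝[<] T) (𝓝 (⊤ : ℝ≥0∞)))
    (C : ℝ≥0) : ¬ ∀ t ∈ Ico (0 : ℝ) T, FunctionSpaces.eSupNorm (fderiv ℝ (u t)) ≤ C := by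
  intro hC
  have hfin : (C : ℝ≥0∞) * ENNReal.ofReal T < ⊤ :=
    ENNReal.mul_lt_top ENNReal.coe_lt_top ENNReal.ofReal_lt_top
  have hev : ∀ᶠ t in 𝓝[<] T,
      (C : ℝ≥0∞) * ENNReal.ofReal T < ∫⁻ s in Ioo 0 t, FunctionSpaces.eSupNorm (fderiv ℝ (u s)) :=
    hdiv.eventually (lt_mem_nhds hfin)
  have hwin : ∀ᶠ t in 𝓝[<] T, t ∈ Ioo (0 : ℝ) T := Ioo_mem_nhdsLT hT
  obtain ⟨t, ht, htw⟩ := (hev.and hwin).exists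
  have hle : ∫⁻ s in Ioo 0 t, FunctionSpaces.eSupNorm (fderiv ℝ (u s)) ≤
      (C : ℝ≥0∞) * volume (Ioo (0 : ℝ) t) :=
    (setLIntegral_mono' measurableSet_Ioo fun s hs => hC s ⟨hs.1.le, hs.2.trans htw.2⟩).trans_eq
      (setLIntegral_const _ _)
  have hvol : volume (Ioo (0 : ℝ) t) ≤ ENNReal.ofReal T := by
    rw [Real.volume_Ioo, sub_zero]
    exact ENNReal.ofReal_le_ofReal htw.2.le
  have : (C : ℝ≥0∞) * volume (Ioo (0 : ℝ) t) ≤ (C : ℝ≥0∞) * ENNReal.ofReal T :=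
    mul_le_mul_right hvol (C : ℝ≥0∞)
  exact absurd (ht.trans_le (hle.trans this)) (lt_irrefl _)

/-- From the claim: for every ring radius `r₀ > 0`, an axisymmetric `C^{1,α}` finite-energy classical
Euler flow WITH swirl on `ℝ³ × [0,T)`, smooth off the ring initially, whose velocity gradient is not
uniformly bounded on `[0,T)`. [cite: ElgindiPasqualotto2023, Thm 1.3 (p. 4)] -/
theorem swirlDrivenHolderBlowup.exists_blowup (h : swirlDrivenHolderBlowup) {r₀ : ℝ} (hr₀ : 0 < r₀) :
    ∃ (α : ℝ≥0) (T : ℝ) (u : ℝ → EuclideanSpace ℝ (Fin 3) → EuclideanSpace ℝ (Fin 3))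
      (p : ℝ → EuclideanSpace ℝ (Fin 3) → ℝ), 0 < α ∧ 0 < T ∧
      IsClassicalEulerOnDomain (Ico 0 T) (⊤ : TopologicalSpace.Opens (EuclideanSpace ℝ (Fin 3)))
        0 0 u p ∧
      IsAxisymmetric (u 0) ∧ ¬ HasNoSwirl (u 0) ∧ ContDiffOn ℝ ∞ (u 0) (horizontalCircle r₀)ᶜ ∧
      ∀ C : ℝ≥0, ¬ ∀ t ∈ Ico (0 : ℝ) T, FunctionSpaces.eSupNorm (fderiv ℝ (u t)) ≤ C := by
  obtain ⟨α, u₀, hα, -, -, -, hax, hsw, hsm, T, hT, u, p, hsol, h0, -, hdiv⟩ := h r₀ hr₀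
  refine ⟨α, T, u, p, hα, hT, hsol, ?_, ?_, ?_, not_lipschitzBound hT hdiv⟩
  · rwa [h0]
  · rwa [h0]
  · rwa [h0]

end ElgindiPasqualotto2023

end Literature.Analysis.FluidPDE
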